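import Literature.Computability.AlgebraicComplexity.TableauEvalBridge
import Mathlib.GroupTheory.Perm.Fin
import HarnessLib

/-!
# Row expansion of column alternators: peeling the top box of a column

Lean checker of the GCT multiplicity-obstruction engine (cell `pub-gct`; honest framing: rung-1
multiplicity-obstruction search for permanent versus determinant at small `(n, m)`, no claim about
VP ≠ VNP or P ≠ NP). Combinatorial core of the correctness proof of the label-major evaluator
(`TableauEvalLabelMajor.lean`): a signed sum over the bijections `π ∈ 𝔖_h` of a column of height
`h = n + 1` is the sum over the variable `j` given to the TOP box, with sign `(-1)^j`, of the signed
sums over the bijections of the residual column (variable `j` erased) — the row expansion of the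
alternator `e_{v_0} ∧ ⋯ ∧ e_{v_n}` along its first row. Formally:

* §1 `consPerm j π' ∈ 𝔖_{n+1}` (`0 ↦ j`, `r+1 ↦ j.succAbove (π' r)`), its sign `(-1)^j · sign π'`,
  and the equivalence `Fin (n+1) × 𝔖_n ≃ 𝔖_{n+1}` it defines (`sum_perm_succ`); signs are
  handed to the user as INTEGERS (`(sign π : ℤ)`), powers of `-1 : ℤˣ` being awkward to rewrite;
* §2 **`sum_perm_permVars`**: for a column `c` with a nonempty variable list and any additive
  function `Φ` of (sign, variables in row order),
  `∑_π Φ (sign π) (permVars c π) = ∑_j ∑_{π'} Φ ((-1)^j sign π') (c.vars[j] :: permVars (c.peel j) π')`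
  where `c.peel j` erases the `j`-th variable (and the top label);
* §3 **`multiPeel`**: the same for a TUPLE of columns `col : Fin C → Column` with activity flags
  `act : Fin C → Bool` — a sum over tuples of column bijections of any function of the families
  (sign, variables in row order) is the sum over the choices at the active columns (`nchB`,
  `redB`, `epsB`, `preB`) of the sums over the tuples of bijections of the residual columns. This
  is the one-label step of the label-major evaluator, in the form its correctness proof consumes.

Elementary [folklore] (Laplace expansion bookkeeping; cf. Mathlib's `Matrix.det_succ_row_zero`).
-/

noncomputable section

open scoped BigOperators

namespace Literature.Computability.AlgebraicComplexity

namespace TableauEval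

open Equiv

/-! ## §1 Permutations with a prescribed image of `0` -/

/-- The permutation of `Fin (n+1)` sending `0 ↦ j` and `r+1 ↦ j.succAbove (π r)`: the relative
order of the remaining values is that of `π`. [folklore] -/
def consPerm {n : ℕ} (j : Fin (n + 1)) (π : Perm (Fin n)) : Perm (Fin (n + 1)) :=
  (Fin.cycleRange j).symm * Perm.decomposeFin.symm (0, π)

/-- `consPerm j π 0 = j`. [folklore] -/
@[simp] theorem consPerm_zero {n : ℕ} (j : Fin (n + 1)) (π : Perm (Fin n)) : consPerm j π 0 = j := by
  simp [consPerm, Perm.mul_apply, Perm.decomposeFin_symm_apply_zero, Fin.cycleRange_symm_zero]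

/-- `consPerm j π (r+1) = j.succAbove (π r)`. [folklore] -/
@[simp] theorem consPerm_succ {n : ℕ} (j : Fin (n + 1)) (π : Perm (Fin n)) (r : Fin n) :
    consPerm j π r.succ = j.succAbove (π r) := by
  simp [consPerm, Perm.mul_apply, Perm.decomposeFin_symm_apply_succ, Fin.cycleRange_symm_succ]

/-- `sign (consPerm j π) = (-1)^j · sign π`. [folklore] -/
theorem sign_consPerm {n : ℕ} (j : Fin (n + 1)) (π : Perm (Fin n)) :
    Perm.sign (consPerm j π) = (-1) ^ (j : ℕ) * Perm.sign π := by
  rw [consPerm, Perm.sign_mul, Perm.sign_symm, Fin.sign_cycleRange, Perm.decomposeFin.symm_sign,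
    if_pos rfl, one_mul]
  rfl

/-- `((-1)^j : ℤˣ)` as an integer (the power elaborates through `Int.instUnitsPow`, which agrees
with the monoid power definitionally but not syntactically — hence a lemma). [folklore] -/
theorem val_negOne_pow (j : ℕ) : (((-1 : ℤˣ) ^ j : ℤˣ) : ℤ) = (-1 : ℤ) ^ j := by
  induction j with
  | zero => rfl
  | succ j ih =>
    have h1 : ((-1 : ℤˣ) ^ (j + 1)) = (-1 : ℤˣ) ^ j * (-1) := pow_succ _ _
    rw [h1, Units.val_mul, ih, pow_succ]
    rfl

/-- The sign of `consPerm j π` as an integer: `(-1)^j · sign π`. [folklore] -/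
theorem sign_consPerm_int {n : ℕ} (j : Fin (n + 1)) (π : Perm (Fin n)) :
    (Perm.sign (consPerm j π) : ℤ) = (-1) ^ (j : ℕ) * (Perm.sign π : ℤ) := by
  rw [sign_consPerm, Units.val_mul, val_negOne_pow]

/-- `(j, π) ↦ consPerm j π` is injective. [folklore] -/
theorem consPerm_injective (n : ℕ) :
    Function.Injective (fun p : Fin (n + 1) × Perm (Fin n) => consPerm p.1 p.2) := by
  rintro ⟨j, π⟩ ⟨j', π'⟩ h
  have hj : j = j' := by
    have := congrArg (fun σ : Perm (Fin (n + 1)) => σ 0) h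
    simpa using this
  subst hj
  have h2 : Perm.decomposeFin.symm (0, π) = Perm.decomposeFin.symm (0, π') :=
    mul_left_cancel (a := (Fin.cycleRange j).symm) h
  have h3 := Perm.decomposeFin.symm.injective h2
  simp only [Prod.mk.injEq, true_and] at h3
  rw [h3]

/-- **`Fin (n+1) × 𝔖_n ≃ 𝔖_{n+1}`** by `consPerm` (injective between finite types of equal
cardinality `(n+1)·n! = (n+1)!`). [folklore] -/
def consPermEquiv (n : ℕ) : Fin (n + 1) × Perm (Fin n) ≃ Perm (Fin (n + 1)) :=
  Equiv.ofBijective (fun p => consPerm p.1 p.2)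
    ((Fintype.bijective_iff_injective_and_card _).mpr
      ⟨consPerm_injective n, by simp [Fintype.card_perm, Nat.factorial_succ]⟩)

/-- **Row expansion of a signed permutation sum**: `∑_{σ ∈ 𝔖_{n+1}} f σ = ∑_j ∑_{π ∈ 𝔖_n} f (consPerm j π)`.
[folklore] -/
theorem sum_perm_succ {n : ℕ} {M : Type*} [AddCommMonoid M] (f : Perm (Fin (n + 1)) → M) :
    ∑ σ, f σ = ∑ j : Fin (n + 1), ∑ π : Perm (Fin n), f (consPerm j π) := by
  rw [← Fintype.sum_prod_type']
  exact (Fintype.sum_equiv (consPermEquiv n) (fun p => f (consPerm p.1 p.2)) f fun _ => rfl).symm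

/-! ## §2 Peeling the top box of a column -/

/-- The residual column after its topmost box received the `j`-th of its variables: that variable
and the top label are erased. (Identical to `Column.reduce` of `TableauEvalLabelMajor.lean`; kept
here under its own name so that this file does not depend on the programme file.) [folklore] -/
def Column.peel (c : Column) (j : ℕ) : Column := ⟨c.vars.eraseIdx j, c.labels.tail⟩

/-- Values of an erased list: `((v :: vs).eraseIdx j)[k] = (v :: vs)[j.succAbove k]`. [folklore] -/
theorem get_eraseIdx_cons {α : Type*} (v : α) (vs : List α) (j : Fin (vs.length + 1))
    (kk : Fin ((v :: vs).eraseIdx j).length) (k : Fin vs.length) (hk : (kk : ℕ) = k) :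
    ((v :: vs).eraseIdx j).get kk = (v :: vs).get (j.succAbove k) := by
  rw [List.get_eq_getElem, List.getElem_eraseIdx, List.get_eq_getElem]
  by_cases h : (kk : ℕ) < j
  · rw [dif_pos h]
    congr 1
    rw [Fin.succAbove_of_castSucc_lt _ _ (by rw [Fin.lt_def]; simp; omega)]
    simp [hk]
  · rw [dif_neg h]
    congr 1
    rw [Fin.succAbove_of_le_castSucc _ _ (by rw [Fin.le_def]; simp; omega)]
    simp [hk]

/-- **Peeling the top box**: for a column with at least one variable and any function `Φ` of
(sign, variables in row order), the signed sum over the column's bijections is the sum over the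
variable index `j` given to the top box, with sign `(-1)^j`, of the signed sums over the
bijections of the peeled column. [folklore] -/
theorem sum_perm_permVars (c : Column) (hc : c.vars ≠ []) {M : Type*} [AddCommMonoid M]
    (Φ : ℤ → List ℕ → M) :
    ∑ π : Perm (Fin c.vars.length), Φ (Perm.sign π : ℤ) (permVars c π) =
      ∑ j : Fin c.vars.length, ∑ π' : Perm (Fin (c.vars.eraseIdx j).length),
        Φ ((-1) ^ (j : ℕ) * (Perm.sign π' : ℤ)) (c.vars.getD j 0 :: permVars (c.peel j) π') := by
  obtain ⟨vars, labels⟩ := c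
  cases vars with
  | nil => exact absurd rfl hc
  | cons v vs =>
    simp only [List.length_cons]
    rw [sum_perm_succ]
    refine Finset.sum_congr rfl fun j _ => ?_
    -- reindex the residual bijections along the length identity
    have hlen : vs.length = ((v :: vs).eraseIdx j).length := by
      rw [List.length_eraseIdx]; simp [j.isLt]
    let e : Perm (Fin vs.length) ≃ Perm (Fin ((v :: vs).eraseIdx j).length) :=
      Equiv.permCongr (finCongr hlen)
    refine Fintype.sum_equiv e _ _ fun π => ?_
    have hsign : Perm.sign (e π) = Perm.sign π := Perm.sign_permCongr _ _
    rw [hsign, sign_consPerm_int]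
    congr 1
    -- the variables in row order
    show List.ofFn (fun r => (v :: vs).get (consPerm j π r)) =
      (v :: vs).getD j 0 :: List.ofFn (fun r => ((v :: vs).eraseIdx j).get ((e π) r))
    rw [List.ofFn_succ, consPerm_zero, List.getD_eq_getElem _ _ j.isLt, List.get_eq_getElem]
    congr 1
    apply List.ext_get
    · simp [hlen.symm]
    · intro i h1 h2
      rw [List.get_ofFn, List.get_ofFn, consPerm_succ]
      exact (get_eraseIdx_cons v vs j _ _ (by simp [e, Equiv.permCongr_apply])).symm


/-! ## §3 Peeling the top boxes of all active columns of a tuple of columns -/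

/-- Number of choices at a column: its variables if active, one dummy choice if not. [folklore] -/
def nchB : Bool → Column → ℕ
  | true, c => c.vars.length
  | false, _ => 1

/-- Residual column: peeled at `j` if active, unchanged if not. [folklore] -/
def redB : Bool → Column → ℕ → Column
  | true, c, j => c.peel j
  | false, c, _ => c

/-- Sign of a choice (an integer): `(-1)^j` if active, `1` if not. [folklore] -/
def epsB : Bool → ℕ → ℤ
  | true, j => (-1) ^ j
  | false, _ => 1

/-- Variables given to the top box: `[vars[j]]` if active, none if not. [folklore] -/
def preB : Bool → Column → ℕ → List ℕ
  | true, c, j => [c.vars.getD j 0]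
  | false, _, _ => []

/-- `nchB` at an active column. [folklore] -/
@[simp] theorem nchB_true (c : Column) : nchB true c = c.vars.length := rfl
/-- `nchB` at an inactive column. [folklore] -/
@[simp] theorem nchB_false (c : Column) : nchB false c = 1 := rfl
/-- `redB` at an active column. [folklore] -/
@[simp] theorem redB_true (c : Column) (j : ℕ) : redB true c j = c.peel j := rfl
/-- `redB` at an inactive column. [folklore] -/
@[simp] theorem redB_false (c : Column) (j : ℕ) : redB false c j = c := rfl
/-- `epsB` at an active column. [folklore] -/
@[simp] theorem epsB_true (j : ℕ) : epsB true j = (-1) ^ j := rfl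
/-- `epsB` at an inactive column. [folklore] -/
@[simp] theorem epsB_false (j : ℕ) : epsB false j = 1 := rfl
/-- `preB` at an active column. [folklore] -/
@[simp] theorem preB_true (c : Column) (j : ℕ) : preB true c j = [c.vars.getD j 0] := rfl
/-- `preB` at an inactive column. [folklore] -/
@[simp] theorem preB_false (c : Column) (j : ℕ) : preB false c j = [] := rfl

/-- Splitting a sum over dependent tuples on `Fin (n+1)` into head and tail (`Fin.consEquiv`).
[folklore] -/
theorem sum_pi_fin_succ {n : ℕ} (α : Fin (n + 1) → Type*) [∀ i, Fintype (α i)] {M : Type*}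
    [AddCommMonoid M] (F : (∀ i, α i) → M) :
    ∑ f, F f = ∑ a : α 0, ∑ g : (∀ i : Fin n, α i.succ), F (Fin.cons a g) := by
  rw [← (Fin.consEquiv α).sum_comp, Fintype.sum_prod_type]
  rfl

/-- Applying a family of maps to a `Fin.cons` tuple gives a `Fin.cons` tuple. [folklore] -/
theorem map_fin_cons {n : ℕ} {α : Fin (n + 1) → Type*} {β : Fin (n + 1) → Type*}
    (G : ∀ i, α i → β i) (x : α 0) (p : ∀ i : Fin n, α i.succ) :
    (fun i => G i (Fin.cons x p i)) = Fin.cons (G 0 x) (fun i => G i.succ (p i)) := by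
  funext i
  refine Fin.cases ?_ (fun i => ?_) i <;> simp

/-- **Peeling the top boxes of the active columns.** For a tuple of columns `col` and activity
flags `act` (active columns having a variable), a sum over tuples of column bijections of any
function `Ψ` of the families (sign, variables in row order) equals the sum over the choices
`js` (a variable index for every active column, a dummy for the others) and over the tuples of
bijections of the residual columns of `Ψ` at (`epsB · sign`, `preB ++ variables`). [folklore] -/
theorem multiPeel : ∀ (C : ℕ) (col : Fin C → Column) (act : Fin C → Bool)
    (_hne : ∀ i, act i = true → (col i).vars ≠ []) {M : Type*} [AddCommMonoid M]
    (Ψ : (Fin C → ℤ) → (Fin C → List ℕ) → M),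
    ∑ π : (i : Fin C) → Perm (Fin (col i).vars.length),
        Ψ (fun i => (Perm.sign (π i) : ℤ)) (fun i => permVars (col i) (π i)) =
      ∑ js : (i : Fin C) → Fin (nchB (act i) (col i)),
        ∑ π' : (i : Fin C) → Perm (Fin (redB (act i) (col i) (js i)).vars.length),
          Ψ (fun i => epsB (act i) (js i) * (Perm.sign (π' i) : ℤ))
            (fun i => preB (act i) (col i) (js i) ++ permVars (redB (act i) (col i) (js i)) (π' i))
  | 0, col, act, _, M, _, Ψ => by
    rw [Fintype.sum_unique, Fintype.sum_unique, Fintype.sum_unique]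
    congr 1 <;> funext i <;> exact i.elim0
  | C + 1, col, act, hne, M, _, Ψ => by
    -- write `col`, `act` as `Fin.cons` of head and tail
    obtain ⟨c0, ct, rfl⟩ : ∃ c0 ct, col = Fin.cons c0 ct :=
      ⟨col 0, fun i => col i.succ, by funext i; refine Fin.cases ?_ (fun k => ?_) i <;> simp⟩
    obtain ⟨b, t, rfl⟩ : ∃ b t, act = Fin.cons b t :=
      ⟨act 0, fun i => act i.succ, by funext i; refine Fin.cases ?_ (fun k => ?_) i <;> simp⟩
    have h0 : b = true → c0.vars ≠ [] := fun h => hne 0 (by simpa using h)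
    have IH := multiPeel C ct t (fun i h => hne i.succ (by simpa using h)) (M := M)
    -- (1) split the left-hand tuple into head `a` and tail; rewrite the tail by the induction
    -- hypothesis with the head frozen into `Ψ`
    rw [sum_pi_fin_succ (fun i => Perm (Fin ((Fin.cons c0 ct : Fin (C + 1) → Column) i).vars.length))]
    have step : ∀ a : Perm (Fin c0.vars.length),
        ∑ g : ((i : Fin C) → Perm (Fin (ct i).vars.length)),
          Ψ (fun i => (Perm.sign (Fin.cons
              (α := fun i => Perm (Fin ((Fin.cons c0 ct : Fin (C + 1) → Column) i).vars.length)) a g i)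
              : ℤ))
            (fun i => permVars ((Fin.cons c0 ct : Fin (C + 1) → Column) i) (Fin.cons
              (α := fun i => Perm (Fin ((Fin.cons c0 ct : Fin (C + 1) → Column) i).vars.length)) a g i)) =
        ∑ js : (i : Fin C) → Fin (nchB (t i) (ct i)),
          ∑ π' : (i : Fin C) → Perm (Fin (redB (t i) (ct i) (js i)).vars.length),
            Ψ (Fin.cons (Perm.sign a : ℤ) (fun i => epsB (t i) (js i) * (Perm.sign (π' i) : ℤ)))
              (Fin.cons (permVars c0 a) (fun i => preB (t i) (ct i) (js i) ++
                permVars (redB (t i) (ct i) (js i)) (π' i))) := by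
      intro a
      simp only [map_fin_cons (fun i (π : Perm (Fin ((Fin.cons c0 ct : Fin (C + 1) → Column)
          i).vars.length)) => (Perm.sign π : ℤ)),
        map_fin_cons (fun i (π : Perm (Fin ((Fin.cons c0 ct : Fin (C + 1) → Column)
          i).vars.length)) => permVars ((Fin.cons c0 ct : Fin (C + 1) → Column) i) π)]
      exact IH (fun s w => Ψ (Fin.cons (Perm.sign a : ℤ) s) (Fin.cons (permVars c0 a) w))
    refine Eq.trans (Finset.sum_congr rfl fun a _ => step a) ?_
    clear step IH
    -- (2) split the right-hand tuples `js` and `π'` into head and tail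
    rw [sum_pi_fin_succ (fun i => Fin (nchB ((Fin.cons b t : Fin (C + 1) → Bool) i)
      ((Fin.cons c0 ct : Fin (C + 1) → Column) i)))]
    refine Eq.trans ?_ (Finset.sum_congr rfl fun j0 _ => Finset.sum_congr rfl fun jst _ =>
      (sum_pi_fin_succ (fun i => Perm (Fin (redB ((Fin.cons b t : Fin (C + 1) → Bool) i)
        ((Fin.cons c0 ct : Fin (C + 1) → Column) i)
        (Fin.cons (α := fun i => Fin (nchB ((Fin.cons b t : Fin (C + 1) → Bool) i)
          ((Fin.cons c0 ct : Fin (C + 1) → Column) i))) j0 jst i)).vars.length)) _).symm)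
    -- (3) case on the activity of the head column
    cases b with
    | false =>
      rw [Finset.sum_comm]
      refine Eq.trans ?_ (Fin.sum_univ_one _).symm
      refine Finset.sum_congr rfl fun jst _ => Finset.sum_congr rfl fun a _ =>
        Finset.sum_congr rfl fun πt _ => ?_
      congr 1 <;> funext i <;> refine Fin.cases ?_ (fun k => ?_) i <;>
        first | rfl | (simp; rfl)
    | true =>
      refine Eq.trans (sum_perm_permVars c0 (h0 rfl) (fun s w =>
        ∑ jst : (i : Fin C) → Fin (nchB (t i) (ct i)),
          ∑ π' : (i : Fin C) → Perm (Fin (redB (t i) (ct i) (jst i)).vars.length),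
            Ψ (Fin.cons s (fun i => epsB (t i) (jst i) * (Perm.sign (π' i) : ℤ)))
              (Fin.cons w (fun i => preB (t i) (ct i) (jst i) ++
                permVars (redB (t i) (ct i) (jst i)) (π' i))))) ?_
      refine Finset.sum_congr rfl fun j0 _ => ?_
      rw [Finset.sum_comm]
      refine Finset.sum_congr rfl fun jst _ => Finset.sum_congr rfl fun π0 _ =>
        Finset.sum_congr rfl fun πt _ => ?_
      congr 1 <;> funext i <;> refine Fin.cases ?_ (fun k => ?_) i <;> rfl

end TableauEval

end Literature.Computability.AlgebraicComplexity

end
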